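import Summits.RiemannHypothesis.RiemannHypothesis.Theorems.Splittings.RobinFiniteE3Error
import Summits.RiemannHypothesis.RiemannHypothesis.Theorems.Splittings.RobinFiniteTailFree
import HarnessLib

/-!
# Splittings — Robin finite lens, E3 (the CA Mertens certificate re-read with window hypotheses), part 6/6, §F

Cell rh-split, seat rh-split-robin-finite g7 (brief sha16 f79c5f09d8bcb036), card `run/shared/lean/pub/rh-split/cards/SPLIT-robin-finite.md` §14
(referee rh-split-ref g3 REFEREE ADDENDUM (robin, finite) §14 DELIVERABLE + REPLAY ×2 2026-08-27T05:39:31Z; lead rh-split-lead g3 RULING #24: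
zero-def variant of record); cut of `HOME/rh-split-robin-finite/SketchG7-E3-zerodef.lean` (sha16 c3a3285c0daab218, 1644 l, 52 thms, ZERO defs —
generated by the seat from SketchG7-E3.lean deb49c670b0d4cda by spelling out `ThetaWindow` / `EBoxOn` / `Eb` / `budgetPT`) into SIX files
(`RobinFiniteE3Window` §A, `…Combine` §B, `…Cells` §C, `…Large` §D, `…Error` §E, `…Main` §F; the card's five-file plan puts §A+§B in one
file, which is 428 l > the 400-line rule), filed by rh-split-typer-1 g4.  Decl blocks byte-identical to the scratch; one namespace
`…Theorems.Splittings.RobinFiniteE3` (scratch: `…Splittings.RobinFinite.E3Z`).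

This part — part 6/6, §F: the main estimate with hypotheses `−log f(P) ≤ E`, `E < G₁ + G₂` (`mertens_prod_lt_of`), `thetaWindow_PT`, `negLog_le_Eb_PT`, and the
HEADLINE `mertensProdLt_PT : Buthe2016_thm2 → Buthe2018_thm2_theta → BroadbentEtAl2021_theta_rel_1e19 → RiemannHypothesisUpTo 3000175332800 →
∀ P Q, 4¹¹ ≤ P → P ≤ 2.5·10²⁰ → Q ≤ P → MertensProdLt P Q`, whence `robinCA_below_PT` (Robin at every CA number `> 5040` with all primes
`≤ 2.5·10²⁰`), modulo the four PRINT theorems in hypothesis position.  The only part importing `RobinFiniteTailFree` (p496363).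

E3 of the card's exchange lemma = the MECHANICAL RE-READ of the tree's CA Mertens certificate `RobinAnalyticSharp.mertens_prod_lt_RH`
with its two RH uses replaced: (θ) Schoenfeld's `|θ t − t| ≤ √t log² t/(8π)` by a WINDOW hypothesis `∀ y ∈ [599, B], |θ y − y| ≤ √y log² y/(8π)`
(spelled out), and (f) Nicolas's `−log f(P) ≤ E_RH(P)` by an ABSTRACT error value / function, so that the tree's RH-free inputs
`RobinFiniteE1c.schoenfeldThetaOn_of_buthe2016` and `RobinFiniteTail(Free).nicolasLowerBetween_PT_tailFree` plug in (in `…Main`).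
No new analytic idea: every proof is the tree's, with `hS hRH` ↦ `hW … (t ≤ B)` and `nicolasERH_mul_le` ↦ a hypothesis.
HONEST LABEL: «SPLITTING SEARCH over kernel-typed RH-EQUIVALENCES; a splitting A ∧ B ⟹ RH is CONDITIONAL bookkeeping
unless A and B are both proved; nothing here bears on the truth of RH.»  Referee labels: class (robin, finite) UNCHANGED (RELABELLING ×4,
tail-rigid); the conditional headline's modulo-list is PRINT-ONLY {Buthe2016_thm2, Buthe2018_thm2_theta, BroadbentEtAl2021_theta_rel_1e19, RH(H₀)}.
-/

set_option linter.dupNamespace false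

noncomputable section

open Real Filter Finset
open scoped Chebyshev

namespace Summit.RiemannHypothesis.RiemannHypothesis.Theorems.Splittings.RobinFiniteE3

open Literature.NumberTheory.LFunctions Literature.NumberTheory.DiophantineGeometry
open RobinAnalyticSharp

/-! ## §F · The main estimate with hypotheses, and the headline -/

/-- **The tree's RH-free windowed lower bound, restated**: modulo Büthe 2016 (Thm 2), Büthe 2018 (Thm 2),
BKLNW 2021 and RH up to `3 000 175 332 800`, `−log f(x) ≤ Eb (budgetPT X₀ X₁) x` for `599 ≤ x ∈ [X₀, X₁]`,
`1 < X₀`, `X₁ ≤ 2.169·10²⁵` (`RobinFiniteTail.nicolasLowerBetween_PT_tailFree`, by `rfl` on the shape). -/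
theorem negLog_le_Eb_PT (h16 : Buthe2016_thm2) (hB : Buthe2018_thm2_theta)
    (hK : BroadbentEtAl2021_theta_rel_1e19) (hRH : RiemannHypothesisUpTo 3000175332800)
    {X₀ X₁ : ℝ} (hX₀ : 1 < X₀) (hX₁ : X₁ ≤ 2.169e25) {x : ℝ} (hx : 599 ≤ x) (h0 : X₀ ≤ x) (h1 : x ≤ X₁) :
    -Real.log (nicolasF x) ≤ (nicolasERH x + ((0.0463 + 2 * (1 + 2 / Real.log X₀) * (2.961e-12 * √X₁)) - nicolasBeta) * (1 / (√x * Real.log x) + 1 / (√x * Real.log x ^ 2) + 4 / (√x * Real.log x ^ 3))) :=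
  Theorems.Splittings.RobinFiniteTail.nicolasLowerBetween_PT_tailFree h16 hB hK hRH hX₀ hX₁ x hx h0 h1

/-- Product form: `−log f(x) ≤ E` gives `(∏_{p ≤ x} (1 − 1/p))⁻¹ ≤ e^γ · log θ(x) · e^E` (`x ≥ 599`)
(`prod_le_RH` with the lower bound as a hypothesis). -/
theorem prod_le_of_neg_log_le {x E : ℝ} (hx : 599 ≤ x) (h1 : -Real.log (nicolasF x) ≤ E) :
    (∏ p ∈ Nat.primesLE ⌊x⌋₊, (1 - (p : ℝ)⁻¹))⁻¹ ≤
      rexp eulerMascheroniConstant * Real.log (θ x) * rexp E := by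
  have hx3 : (3 : ℝ) ≤ x := le_trans (by norm_num) hx
  have hf : 0 < nicolasF x := nicolasF_pos hx3
  have hA : 0 < rexp eulerMascheroniConstant * Real.log (θ x) :=
    mul_pos (Real.exp_pos _) (Real.log_pos (one_lt_theta hx3))
  have h2 : (nicolasF x)⁻¹ ≤ rexp E := by
    have : (nicolasF x)⁻¹ = rexp (-Real.log (nicolasF x)) := by
      rw [Real.exp_neg, Real.exp_log hf]
    rw [this]
    exact Real.exp_le_exp.2 h1
  have h3 : (∏ p ∈ Nat.primesLE ⌊x⌋₊, (1 - (p : ℝ)⁻¹))⁻¹ =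
      rexp eulerMascheroniConstant * Real.log (θ x) * (nicolasF x)⁻¹ := by
    have hnf : nicolasF x = (rexp eulerMascheroniConstant * Real.log (θ x)) *
        ∏ p ∈ Nat.primesLE ⌊x⌋₊, (1 - (p : ℝ)⁻¹) := rfl
    rw [hnf, mul_inv, ← mul_assoc, mul_inv_cancel₀ hA.ne', one_mul]
  rw [h3]
  exact mul_le_mul_of_nonneg_left h2 hA.le

/-- **Main estimate with hypotheses** (`mertens_prod_lt_RH` verbatim with (f) `−log f(P) ≤ E` and the key
inequality `E < G₂ + G₁` as HYPOTHESES and the `θ`-bound from the window): for naturals `P ≥ 4¹¹`, `P ≤ B`,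
`(∏_{p≤P}(1 − 1/p))⁻¹ · ∏_{Q<p≤P}(1 − 1/p²) < e^γ log(θ(P) + θ(Q))`. -/
theorem mertens_prod_lt_of {B : ℝ} (hW : (∀ y : ℝ, 599 ≤ y → y ≤ B → |θ y - y| ≤ √y * Real.log y ^ 2 / (8 * π))) {P Q : ℕ} {E : ℝ} (hP : 4 ^ 11 ≤ P)
    (hPB : (P : ℝ) ≤ B) (hfE : -Real.log (nicolasF P) ≤ E)
    (h3 : E <
      ∑ p ∈ (Nat.primesLE P).filter (fun p => Q < p), ((p : ℝ) ^ 2)⁻¹ +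
        θ Q / ((θ P + θ Q) * Real.log (θ P + θ Q))) :
    (∏ p ∈ Nat.primesLE P, (1 - (p : ℝ)⁻¹))⁻¹ *
        ∏ p ∈ (Nat.primesLE P).filter (fun p => Q < p), (1 - ((p : ℝ) ^ 2)⁻¹) <
      rexp eulerMascheroniConstant * Real.log (θ P + θ Q) := by
  have hPr : (4 : ℝ) ^ 11 ≤ P := by exact_mod_cast hP
  have hP599 : (599 : ℝ) ≤ P := le_trans (by norm_num) hPr
  have hP0 : (0 : ℝ) < P := by linarith
  -- θ bounds at `P`
  obtain ⟨hθPl, -⟩ := theta_two_sidedW hW hP599 le_rfl hPB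
  have hδP := schoenfeldDelta_le hP599
  have hθP1 : 1 < θ P := by
    have : (1 - 0.0666) * 599 ≤ (1 - schoenfeldDelta P) * (P : ℝ) :=
      mul_le_mul (by linarith) hP599 (by norm_num) (by linarith [schoenfeldDelta_nonneg (P : ℝ)])
    linarith
  set S := ∑ p ∈ (Nat.primesLE P).filter (fun p => Q < p), ((p : ℝ) ^ 2)⁻¹ with hSdef
  set R := θ P + θ Q with hR
  set A := Real.log (θ P) with hA
  have hA0 : 0 < A := Real.log_pos hθP1
  have hθQ0 : 0 ≤ θ Q := Chebyshev.theta_nonneg _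
  have hR1 : 1 < R := by linarith
  have hlogR0 : 0 < Real.log R := Real.log_pos hR1
  -- (1) `∏(1-1/p)⁻¹ ≤ e^γ · A · e^E`
  have h1 : (∏ p ∈ Nat.primesLE P, (1 - (p : ℝ)⁻¹))⁻¹ ≤
      rexp eulerMascheroniConstant * A * rexp E := by
    have h := prod_le_of_neg_log_le (x := (P : ℝ)) hP599 hfE
    rwa [Nat.floor_natCast] at h
  -- (2) `∏(1-1/p²) ≤ e^{-S}`
  have h2 : ∏ p ∈ (Nat.primesLE P).filter (fun p => Q < p), (1 - ((p : ℝ) ^ 2)⁻¹) ≤ rexp (-S) := by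
    refine RobinAnalytic.prod_one_sub_le_exp_neg_sum _ _ fun p hp => ?_
    have hp' := Nat.prime_of_mem_primesLE (Finset.mem_filter.1 hp).1
    have : (1 : ℝ) ≤ (p : ℝ) ^ 2 := by
      have : (1 : ℝ) ≤ p := by exact_mod_cast hp'.one_lt.le
      nlinarith
    exact inv_le_one_of_one_le₀ this
  have hPi0 : 0 ≤ ∏ p ∈ (Nat.primesLE P).filter (fun p => Q < p), (1 - ((p : ℝ) ^ 2)⁻¹) :=
    Finset.prod_nonneg fun p hp => by
      have hp' := Nat.prime_of_mem_primesLE (Finset.mem_filter.1 hp).1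
      have : (1 : ℝ) ≤ (p : ℝ) ^ 2 := by
        have : (1 : ℝ) ≤ p := by exact_mod_cast hp'.one_lt.le
        nlinarith
      linarith [inv_le_one_of_one_le₀ this]
  have h4 : θ Q / (R * Real.log R) ≤ Real.log (Real.log R) - Real.log A := by
    have hθPpos : 0 < θ P := by linarith
    have hRA : Real.log R - A = Real.log (R / θ P) := by
      rw [hA, Real.log_div (by linarith) hθPpos.ne']
    have h5 : θ Q / R ≤ Real.log R - A := by
      rw [hRA]
      have := Real.one_sub_inv_le_log_of_pos (x := R / θ P) (by positivity)
      have e1 : 1 - (R / θ P)⁻¹ = θ Q / R := by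
        rw [hR]
        field_simp
        ring
      linarith
    have h6 : (Real.log R - A) / Real.log R ≤ Real.log (Real.log R) - Real.log A := by
      rw [← Real.log_div hlogR0.ne' hA0.ne']
      have := Real.one_sub_inv_le_log_of_pos (x := Real.log R / A) (by positivity)
      have e1 : 1 - (Real.log R / A)⁻¹ = (Real.log R - A) / Real.log R := by
        field_simp
      linarith
    calc θ Q / (R * Real.log R) = θ Q / R / Real.log R := by rw [div_div]
      _ ≤ (Real.log R - A) / Real.log R := div_le_div_of_nonneg_right h5 hlogR0.le
      _ ≤ Real.log (Real.log R) - Real.log A := h6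
  -- (5) `A · exp(E - S) < log R`
  have h7 : A * rexp (E - S) < Real.log R := by
    have h8 : E - S < Real.log (Real.log R) - Real.log A := by linarith [h3, h4]
    have h9 : rexp (E - S) < Real.log R / A := by
      calc rexp (E - S) < rexp (Real.log (Real.log R) - Real.log A) := Real.exp_lt_exp.2 h8
        _ = Real.log R / A := by rw [Real.exp_sub, Real.exp_log hlogR0, Real.exp_log hA0]
    have := mul_lt_mul_of_pos_left h9 hA0
    rwa [mul_div_cancel₀ _ hA0.ne'] at this
  calc (∏ p ∈ Nat.primesLE P, (1 - (p : ℝ)⁻¹))⁻¹ *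
        ∏ p ∈ (Nat.primesLE P).filter (fun p => Q < p), (1 - ((p : ℝ) ^ 2)⁻¹)
      ≤ (rexp eulerMascheroniConstant * A * rexp E) * rexp (-S) := by
        calc _ ≤ (rexp eulerMascheroniConstant * A * rexp E) *
              ∏ p ∈ (Nat.primesLE P).filter (fun p => Q < p), (1 - ((p : ℝ) ^ 2)⁻¹) :=
              mul_le_mul_of_nonneg_right h1 hPi0
          _ ≤ (rexp eulerMascheroniConstant * A * rexp E) * rexp (-S) :=
              mul_le_mul_of_nonneg_left h2 (by positivity)
    _ = rexp eulerMascheroniConstant * (A * rexp (E - S)) := by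
        rw [Real.exp_sub, Real.exp_neg]; ring
    _ < rexp eulerMascheroniConstant * Real.log R :=
        mul_lt_mul_of_pos_left h7 (Real.exp_pos _)

/-- The `θ`-window up to `2.169·10²⁵` from Büthe 2016 (Thm 2) + RH verified to `3 000 175 332 800`
(tree: `RobinFiniteE1c.schoenfeldThetaOn_of_buthe2016`). -/
theorem thetaWindow_PT (h16 : Buthe2016_thm2) (hRH : RiemannHypothesisUpTo 3000175332800) :
    (∀ y : ℝ, 599 ≤ y → y ≤ 2.169e25 → |θ y - y| ≤ √y * Real.log y ^ 2 / (8 * π)) :=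
  Theorems.Splittings.RobinFiniteE1c.schoenfeldThetaOn_of_buthe2016 h16 hRH le_rfl

/-- **HEADLINE (E3 re-read + E1c + tail-free zero budget): the CA Mertens–Nicolas inequality for
`4¹¹ ≤ P ≤ 2.5·10²⁰`, `Q ≤ P`, from Büthe 2016 (Thm 2), Büthe 2018 (Thm 2, `θ`-lines), BKLNW 2021 (`θ`, `x ≥ 10¹⁹`)
and RH verified to height `3 000 175 332 800` (Platt–Trudgian) ONLY** — verbatim the conclusion of
`RobinAnalyticSharp.mertens_prod_lt_RH`, without `RiemannHypothesis`.  Cells `4¹¹ ≤ P < 2·10¹⁰` at budget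
`0.04631` (certificates `cover11RH_ok … cover17RH_ok`), six large windows up to `2.5·10²⁰` against `2.1538`. -/
theorem mertensProdLt_PT (h16 : Buthe2016_thm2) (hB : Buthe2018_thm2_theta)
    (hK : BroadbentEtAl2021_theta_rel_1e19) (hRH : RiemannHypothesisUpTo 3000175332800) {P Q : ℕ}
    (hP : 4 ^ 11 ≤ P) (hPX : (P : ℝ) ≤ 25 * (10 : ℝ) ^ 19) (hQP : Q ≤ P) :
    (∏ p ∈ Nat.primesLE P, (1 - (p : ℝ)⁻¹))⁻¹ *
        ∏ p ∈ (Nat.primesLE P).filter (fun p => Q < p), (1 - ((p : ℝ) ^ 2)⁻¹) <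
      rexp eulerMascheroniConstant * Real.log (θ P + θ Q) := by
  have hW : (∀ y : ℝ, 599 ≤ y → y ≤ 2.169e25 → |θ y - y| ≤ √y * Real.log y ^ 2 / (8 * π)) := thetaWindow_PT h16 hRH
  have hPB : (P : ℝ) ≤ 2.169e25 := hPX.trans (by norm_num)
  have hPr : (4 : ℝ) ^ 11 ≤ P := by exact_mod_cast hP
  have hP599 : (599 : ℝ) ≤ P := le_trans (by norm_num) hPr
  have hP1 : (1 : ℝ) < P := by linarith
  have hlow : ∀ X₀ X₁ : ℝ, 1 < X₀ → X₁ ≤ 2.169e25 → X₀ ≤ (P : ℝ) → (P : ℝ) ≤ X₁ →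
      -Real.log (nicolasF P) ≤ (nicolasERH P + ((0.0463 + 2 * (1 + 2 / Real.log X₀) * (2.961e-12 * √X₁)) - nicolasBeta) * (1 / (√P * Real.log P) + 1 / (√P * Real.log P ^ 2) + 4 / (√P * Real.log P ^ 3))) :=
    fun X₀ X₁ hX₀ hX₁ h0 h1 => negLog_le_Eb_PT h16 hB hK hRH hX₀ hX₁ hP599 h0 h1
  by_cases hbig : (2 * 10 ^ 10 : ℝ) ≤ P
  · -- the large branch: the window containing `P`
    have hG := G_largeW hW hbig hPB hQP
    have hsL : 0 < √(P : ℝ) * Real.log P :=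
      mul_pos (Real.sqrt_pos.2 (by linarith)) (Real.log_pos hP1)
    suffices hwin : ∃ X₀ X₁ : ℝ, 1 < X₀ ∧ X₁ ≤ 2.169e25 ∧ X₀ ≤ (P : ℝ) ∧ (P : ℝ) ≤ X₁ ∧
        (nicolasERH P + ((0.0463 + 2 * (1 + 2 / Real.log X₀) * (2.961e-12 * √X₁)) - nicolasBeta) * (1 / (√P * Real.log P) + 1 / (√P * Real.log P ^ 2) + 4 / (√P * Real.log P ^ 3))) * (√(P : ℝ) * Real.log P) < 2.1538 by
      obtain ⟨X₀, X₁, hX₀, hX₁, h0, h1, hlt⟩ := hwin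
      refine mertens_prod_lt_of hW hP hPB (hlow X₀ X₁ hX₀ hX₁ h0 h1) ?_
      have : (nicolasERH P + ((0.0463 + 2 * (1 + 2 / Real.log X₀) * (2.961e-12 * √X₁)) - nicolasBeta) * (1 / (√P * Real.log P) + 1 / (√P * Real.log P ^ 2) + 4 / (√P * Real.log P ^ 3))) < 2.1538 / (√(P : ℝ) * Real.log P) := by
        rw [lt_div_iff₀ hsL]; exact hlt
      exact this.trans_le hG
    rcases le_or_gt (P : ℝ) ((10 : ℝ) ^ 16) with h1 | h1
    · exact ⟨_, _, by norm_num, by norm_num, hbig, h1, Eb_lt_W1 hbig h1⟩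
    rcases le_or_gt (P : ℝ) ((10 : ℝ) ^ 19) with h2 | h2
    · exact ⟨_, _, by norm_num, by norm_num, h1.le, h2, Eb_lt_W2 h1.le h2⟩
    rcases le_or_gt (P : ℝ) (5 * (10 : ℝ) ^ 19) with h3 | h3
    · exact ⟨_, _, by norm_num, by norm_num, h2.le, h3, Eb_lt_W3 h2.le h3⟩
    rcases le_or_gt (P : ℝ) (125 * (10 : ℝ) ^ 18) with h4 | h4
    · exact ⟨_, _, by norm_num, by norm_num, h3.le, h4, Eb_lt_W4 h3.le h4⟩
    rcases le_or_gt (P : ℝ) (2 * (10 : ℝ) ^ 20) with h5 | h5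
    · exact ⟨_, _, by norm_num, by norm_num, h4.le, h5, Eb_lt_W5 h4.le h5⟩
    · exact ⟨_, _, by norm_num, by norm_num, h5.le, hPX, Eb_lt_W6 h5.le hPX⟩
  · -- the cells `4¹¹ ≤ P < 2·10¹⁰ < 4¹⁸`, budget `budgetPT 4¹¹ (2·10¹⁰) ≤ 0.04631`
    rw [not_le] at hbig
    have hP18 : P < 4 ^ 18 := by
      have : (P : ℝ) < 4 ^ 18 := hbig.trans (by norm_num)
      exact_mod_cast this
    have h1 := hlow ((4 : ℝ) ^ 11) (2 * 10 ^ 10) (by norm_num) (by norm_num) hPr hbig.le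
    have h1' := h1.trans (Eb_mono hP1 budgetPT_cells_le)
    refine mertens_prod_lt_of hW hP hPB h1' ?_
    have hb : nicolasBeta ≤ 0.04631 := by linarith [FordL33.nicolasBeta_lt_d5]
    have hb' : (0.04631 : ℝ) * 1.1875 ≤ ((Cells.bU : ℚ) : ℝ) := by
      simp only [Cells.bU]; push_cast; norm_num
    exact key_ineq_cellsW hW (eboxOn_Eb hb hb') hP hP18 hPB hQP

open scoped ArithmeticFunction.sigma in
/-- **COROLLARY: Robin's inequality at every colossally abundant `N > 5040` all of whose primes are
`≤ 2.5·10²⁰`** (`robinCA_below (25·10¹⁹ + 1)`), modulo the same three RH-free named facts and RH(3·10¹²):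
the CA bookkeeping of `Robin1984_thm1_colossallyAbundant_of_sharp` / the card's `finCA_of_exchange`, with
`mertens_prod_lt_RH hRH` replaced by `mertensProdLt_PT`, and the kernel theorem `robinCA_below_four_pow_eleven`
below `4¹¹`. -/
theorem robinCA_below_PT (h16 : Buthe2016_thm2) (hB : Buthe2018_thm2_theta)
    (hK : BroadbentEtAl2021_theta_rel_1e19) (hRH : RiemannHypothesisUpTo 3000175332800) :
    robinCA_below (25 * 10 ^ 19 + 1) := by
  intro N hCA h5040 hprimes
  obtain ⟨ε, P, Q, -, -, hP, hPN, -, hQP, hpf, -, -, hσ, hθ, -⟩ := hCA.exists_structure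
  by_cases hsmall : P < 4 ^ 11
  · refine robinCA_below_four_pow_eleven N hCA h5040 fun p hp hpN => lt_of_le_of_lt ?_ hsmall
    have hN0 : N ≠ 0 := by omega
    have : p ∈ N.primeFactors := Nat.mem_primeFactors.2 ⟨hp, hpN, hN0⟩
    rw [hpf] at this
    exact (Nat.mem_primesLE.1 this).1
  · rw [not_lt] at hsmall
    have hPX : (P : ℝ) ≤ 25 * (10 : ℝ) ^ 19 := by
      have := hprimes P hP hPN
      exact_mod_cast Nat.lt_succ_iff.1 this
    have hlt := mertensProdLt_PT h16 hB hK hRH hsmall hPX hQP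
    have hN0 : N ≠ 0 := by omega
    have hNpos : (0 : ℝ) < N := by exact_mod_cast Nat.pos_of_ne_zero hN0
    have hθpos : 0 < θ P + θ Q := by
      have h1 : 0 < θ (P : ℝ) := Chebyshev.theta_pos (by exact_mod_cast hP.two_le)
      have h2 : 0 ≤ θ (Q : ℝ) := Chebyshev.theta_nonneg _
      linarith
    have hlog : Real.log (θ P + θ Q) ≤ Real.log (Real.log N) := Real.log_le_log hθpos hθ
    have hlt' : (σ 1 N : ℝ) / N < rexp eulerMascheroniConstant * Real.log (Real.log N) :=
      lt_of_le_of_lt hσ (hlt.trans_le (mul_le_mul_of_nonneg_left hlog (Real.exp_pos _).le))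
    unfold robinInequality
    rw [div_lt_iff₀ hNpos] at hlt'
    linarith

/- NOT CARRIED from the scratch: `mertens_cells_of_rh (hRH : RiemannHypothesis) …` (the RH ⟹ cells sanity converse) —
it runs through the tree's `Schoenfeld1976_theta_holds` / Mertens certificates, whose closure contains `native_decide`
axioms (gate whitelist = propext / Classical.choice / Quot.sound); the robin-bridge precedent (RobinSieveDetectors, p470053)
left the RH ⟹ converses out for the same reason. -/

end Summit.RiemannHypothesis.RiemannHypothesis.Theorems.Splittings.RobinFiniteE3

end
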